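import Summits.NavierStokesRegularity.FluidComputer.PalasekTowerClayBridge
import Summits.NavierStokesRegularity.NavierStokesRegularity.Theorems.SoloInformedViscosityNormalisation

/-!
# Viscosity covariance of the E-C interface: one viscosity gives all (ET7 of the E-C typing table)

Cell `ns-blowup`, seat `ns-blowup-ecbridge-1`; companion of `PalasekTowerClayBridge.lean` (LABEL: E-C
typing; WHAT THIS IS NOT: not Navier–Stokes evidence — a change of variables). The time dilation
`u ↦ a·u(a t, x)`, `p ↦ a²·p(a t, x)`, `f ↦ a²·f(a t, x)` (Tao 2013 footnote 3; tree
`isClassicalNSSolutionOn_viscosityChange`, stated with a general force) maps a realisation of the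
tower at viscosity `μ` to one at viscosity `a μ`, with `(T, τ, c₁, c₂, c₃) ↦ (T/a, τ/a, a c₁, a c₂,
c₃/a)` and the SAME rates `R`. The only non-bookkeeping step is that Fefferman's space-time decay (5)
survives the dilation (`hasRapidSpaceTimeDecay_timeRescale`: chain rule for the linear change of
variables `(t, x) ↦ (a t, x)` within the half-space, `ContinuousLinearEquiv.iteratedFDerivWithin_comp_right`,
and `(1 + |x| + t)^K ≤ max(1, a⁻¹)^K (1 + |x| + a t)^K`). Consequence: `PalasekStep2 R` (stated with
`∀ ν > 0`) is equivalent to the inhabitation of `Realisation 1 R` — the crux can be filed at unit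
viscosity.

References: T. Tao, Anal. PDE 6 (2013), footnote 3 [cite: Tao2011, footnote 3]; C. L. Fefferman,
Clay problem description, (4) (5) (6) [cite: FeffermanClay2006, (4) (5) (6)].
-/

noncomputable section

namespace Summit.NavierStokesRegularity.FluidComputer.PalasekTowerClayBridge

open Set MeasureTheory Filter Topology Function
open scoped ENNReal ContDiff NNReal
open Literature.Analysis.FluidPDE
open Summit.NavierStokesRegularity.NavierStokesRegularity.Theorems

section Dilation

variable {E : Type*} [NormedAddCommGroup E] [InnerProductSpace ℝ E]
  {F : Type*} [NormedAddCommGroup F] [NormedSpace ℝ F]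

/-- The space-time dilation `(t, x) ↦ (a t, x)` as a continuous linear equivalence (`a ≠ 0`). [folklore] -/
def timeDilation (E : Type*) [NormedAddCommGroup E] [NormedSpace ℝ E] (a : ℝ) (ha : a ≠ 0) :
    (ℝ × E) ≃L[ℝ] (ℝ × E) :=
  ContinuousLinearEquiv.equivOfInverse
    ((a • ContinuousLinearMap.id ℝ ℝ).prodMap (ContinuousLinearMap.id ℝ E))
    ((a⁻¹ • ContinuousLinearMap.id ℝ ℝ).prodMap (ContinuousLinearMap.id ℝ E))
    (fun z => by
      obtain ⟨t, x⟩ := z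
      simp [inv_mul_cancel_left₀ ha])
    (fun z => by
      obtain ⟨t, x⟩ := z
      simp [mul_inv_cancel_left₀ ha])

omit [InnerProductSpace ℝ E] in
/-- Pointwise formula for the dilation. [folklore] -/
@[simp] theorem timeDilation_apply [NormedSpace ℝ E] (a : ℝ) (ha : a ≠ 0) (z : ℝ × E) :
    timeDilation E a ha z = (a * z.1, z.2) := by
  obtain ⟨t, x⟩ := z
  simp [timeDilation]

/-- Rapid spatial decay (Fefferman (4)) is preserved by constant scalar multiples. [folklore] -/
theorem hasRapidSpatialDecay_const_smul {u₀ : E → F} (hdec : HasRapidSpatialDecay u₀)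
    (hu₀ : ContDiff ℝ ∞ u₀) (c : ℝ) : HasRapidSpatialDecay (fun x => c • u₀ x) := by
  intro n K
  obtain ⟨C, hC⟩ := hdec n K
  refine ⟨‖c‖ * C, fun x => ?_⟩
  have hn : ContDiffAt ℝ n u₀ x := (hu₀.of_le (by exact_mod_cast le_top)).contDiffAt
  rw [iteratedFDeriv_const_smul_apply' hn, norm_smul, mul_left_comm]
  exact mul_le_mul_of_nonneg_left (hC x) (norm_nonneg _)

/-- Joint smoothness on the closed half-space (Fefferman (6)) is preserved by time dilation with
`a ≥ 0`. [folklore] -/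
theorem isSmoothOnHalfSpace_timeRescale {w : ℝ → E → F} (h : IsSmoothOnHalfSpace w) {a : ℝ}
    (ha : 0 ≤ a) (c : ℝ) : IsSmoothOnHalfSpace (timeRescale a c w) := by
  have hmaps : MapsTo (fun s => a * s) (Ici (0 : ℝ)) (Ici 0) := fun s hs => mul_nonneg ha hs
  exact IsSmoothSpaceTimeOn.timeRescale (S := Ici 0) (S' := Ici 0) h a c hmaps

/-- **Fefferman's space-time decay (5) is preserved by time dilation** `f ↦ c • f(a t, x)`, `a > 0`
(for `f` smooth on the closed half-space): the `n`-th derivative of the dilated field within the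
half-space is the `n`-th derivative of `c • f` composed with the dilation `L = timeDilation`
(`ContinuousLinearEquiv.iteratedFDerivWithin_comp_right`; the half-space is `L`-invariant), hence
bounded by `‖c‖ ‖L‖ⁿ` times the original at `(a t, x)`, and
`(1 + |x| + t)^K ≤ max(1, a⁻¹)^K (1 + |x| + a t)^K`. [folklore] -/
theorem hasRapidSpaceTimeDecay_timeRescale {f : ℝ → E → F} (hsm : IsSmoothOnHalfSpace f)
    (hdec : HasRapidSpaceTimeDecay f) {a : ℝ} (ha : 0 < a) (c : ℝ) :
    HasRapidSpaceTimeDecay (timeRescale a c f) := by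
  intro n K
  obtain ⟨C, hC⟩ := hdec n K
  set s : Set (ℝ × E) := Ici (0 : ℝ) ×ˢ (univ : Set E) with hsdef
  have hs : UniqueDiffOn ℝ s := (uniqueDiffOn_Ici 0).prod uniqueDiffOn_univ
  set L : (ℝ × E) ≃L[ℝ] (ℝ × E) := timeDilation E a ha.ne' with hLdef
  -- the preimage of the half-space under the dilation is the half-space
  have hpre : (L : ℝ × E → ℝ × E) ⁻¹' s = s := by
    ext z
    simp only [hsdef, mem_preimage, mem_prod, mem_Ici, mem_univ, and_true, hLdef,
      timeDilation_apply]
    exact mul_nonneg_iff_of_pos_left ha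
  -- the dilated field, uncurried, is `(c • F) ∘ L`
  have hunc : uncurry (timeRescale a c f) = (c • uncurry f) ∘ (L : ℝ × E → ℝ × E) := by
    funext z
    obtain ⟨t, x⟩ := z
    simp [timeRescale, hLdef]
  -- constants
  set m : ℝ := max 1 a⁻¹ with hmdef
  have hm1 : 1 ≤ m := le_max_left _ _
  have hma : a⁻¹ ≤ m := le_max_right _ _
  have hm0 : 0 ≤ m := le_trans zero_le_one hm1
  refine ⟨m ^ K * (‖c‖ * (C * ‖(L : (ℝ × E) →L[ℝ] (ℝ × E))‖ ^ n)) , fun t ht x => ?_⟩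
  have hz : ((t, x) : ℝ × E) ∈ s := mk_mem_prod ht (mem_univ _)
  have hLz : L (t, x) = (a * t, x) := by simp [hLdef]
  have hLz_mem : L (t, x) ∈ s := by
    rw [hLz]; exact mk_mem_prod (mul_nonneg ha.le ht) (mem_univ _)
  -- chain rule for the linear change of variables
  have hchain : iteratedFDerivWithin ℝ n (uncurry (timeRescale a c f)) s (t, x) =
      (iteratedFDerivWithin ℝ n (c • uncurry f) s (L (t, x))).compContinuousLinearMap
        fun _ => (L : (ℝ × E) →L[ℝ] (ℝ × E)) := by
    rw [hunc]
    have := L.iteratedFDerivWithin_comp_right (c • uncurry f) hs hLz_mem n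
    rw [hpre] at this
    exact this
  -- pull out the scalar
  have hsmul : iteratedFDerivWithin ℝ n (c • uncurry f) s (L (t, x)) =
      c • iteratedFDerivWithin ℝ n (uncurry f) s (L (t, x)) := by
    have hcd : ContDiffWithinAt ℝ n (uncurry f) s (L (t, x)) :=
      ((hsm (L (t, x)) hLz_mem).of_le (by exact_mod_cast le_top))
    exact iteratedFDerivWithin_const_smul_apply hcd hs hLz_mem
  -- norm bound for the derivative
  have hnorm : ‖iteratedFDerivWithin ℝ n (uncurry (timeRescale a c f)) s (t, x)‖ ≤
      ‖c‖ * ‖iteratedFDerivWithin ℝ n (uncurry f) s (a * t, x)‖ *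
        ‖(L : (ℝ × E) →L[ℝ] (ℝ × E))‖ ^ n := by
    rw [hchain, hsmul, ← hLz]
    refine le_trans (ContinuousMultilinearMap.norm_compContinuousLinearMap_le _ _) ?_
    rw [norm_smul, Finset.prod_const, Finset.card_univ, Fintype.card_fin]
  -- weight comparison `(1 + |x| + t)^K ≤ m^K (1 + |x| + a t)^K`
  have hw1 : 1 + ‖x‖ + t ≤ m * (1 + ‖x‖ + a * t) := by
    have h1 : t ≤ m * (a * t) := by
      have hat : 0 ≤ a * t := mul_nonneg ha.le ht
      calc t = a⁻¹ * (a * t) := by field_simp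
        _ ≤ m * (a * t) := mul_le_mul_of_nonneg_right hma hat
    have h2 : 1 + ‖x‖ ≤ m * (1 + ‖x‖) := le_mul_of_one_le_left (by positivity) hm1
    nlinarith
  have hw : (1 + ‖x‖ + t) ^ K ≤ m ^ K * (1 + ‖x‖ + a * t) ^ K := by
    rw [← mul_pow]
    exact pow_le_pow_left₀ (by positivity) hw1 K
  -- the original bound at the dilated point
  have hCpt := hC (a * t) (mul_nonneg ha.le ht) x
  have hCnn : 0 ≤ C := le_trans (by positivity) hCpt
  calc (1 + ‖x‖ + t) ^ K * ‖iteratedFDerivWithin ℝ n (uncurry (timeRescale a c f)) s (t, x)‖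
      ≤ (m ^ K * (1 + ‖x‖ + a * t) ^ K) *
          (‖c‖ * ‖iteratedFDerivWithin ℝ n (uncurry f) s (a * t, x)‖ *
            ‖(L : (ℝ × E) →L[ℝ] (ℝ × E))‖ ^ n) :=
        mul_le_mul hw hnorm (norm_nonneg _) (by positivity)
    _ = m ^ K * (‖c‖ * (((1 + ‖x‖ + a * t) ^ K *
          ‖iteratedFDerivWithin ℝ n (uncurry f) s (a * t, x)‖) *
            ‖(L : (ℝ × E) →L[ℝ] (ℝ × E))‖ ^ n)) := by ring
    _ ≤ m ^ K * (‖c‖ * (C * ‖(L : (ℝ × E) →L[ℝ] (ℝ × E))‖ ^ n)) := by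
        gcongr

end Dilation

/-! ## The interface is covariant under the viscosity scaling -/

namespace Realisation

variable {μ ν : ℝ} {R : TowerRates}

/-- **Change of viscosity for realisations.** A realisation of the tower with rates `R` at
viscosity `μ > 0` yields one at any viscosity `ν > 0`: with `a = ν/μ`, dilate time by `a`
(`u ↦ a·u(a t, x)`, `p ↦ a²·p(a t, x)`, `f ↦ a²·f(a t, x)`; tree
`isClassicalNSSolutionOn_viscosityChange`); the blow-up time, readout times and envelope constants
become `T/a`, `τ/a`, `a c₁`, `a c₂`, `c₃/a`; the Clay classes (4), (5), (6), the silence of the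
force from the blow-up time on and the slab energies are preserved
(`hasRapidSpatialDecay_const_smul`, `hasRapidSpaceTimeDecay_timeRescale`,
`isSmoothOnHalfSpace_timeRescale`, `lintegral_enorm_sq_const_smul`). [cite: Tao2011, footnote 3] -/
def rescale (W : Realisation μ R) (hμ : 0 < μ) (hν : 0 < ν) : Realisation ν R :=
  let a : ℝ := ν / μ
  have ha : 0 < a := div_pos hν hμ
  have haμ : a * μ = ν := div_mul_cancel₀ ν hμ.ne'
  have hmaps : MapsTo (fun s => a * s) (Ico (0 : ℝ) (W.T / a)) (Ico 0 W.T) := fun s hs =>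
    ⟨mul_nonneg ha.le hs.1, by
      have := mul_lt_mul_of_pos_left hs.2 ha
      rwa [mul_div_cancel₀ _ ha.ne'] at this⟩
  { T := W.T / a
    T_pos := div_pos W.T_pos ha
    u := timeRescale a a W.u
    p := timeRescale a (a ^ 2) W.p
    f := timeRescale a (a ^ 2) W.f
    classical := by
      have h := isClassicalNSSolutionOn_viscosityChange W.classical a hmaps
        (uniqueDiffOn_Ico 0 (W.T / a))
      rwa [haμ] at h
    datum_decay := by
      rw [timeRescale_zero]
      exact hasRapidSpatialDecay_const_smul W.datum_decay W.contDiff_datum a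
    force_smooth := isSmoothOnHalfSpace_timeRescale W.force_smooth ha.le _
    force_decay := hasRapidSpaceTimeDecay_timeRescale W.force_smooth W.force_decay ha _
    force_silent := by
      intro t ht x
      rw [timeRescale_apply]
      have hat : W.T ≤ a * t := by
        have := mul_le_mul_of_nonneg_left ht ha.le
        rwa [mul_div_cancel₀ _ ha.ne'] at this
      rw [W.force_silent (a * t) hat x, smul_zero]
    energy := by
      intro T' hT'
      have haT' : a * T' < W.T := by
        have := mul_lt_mul_of_pos_left hT' ha
        rwa [mul_div_cancel₀ _ ha.ne'] at this
      obtain ⟨C, hC, hb⟩ := W.energy (a * T') haT'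
      refine ⟨ENNReal.ofReal (a ^ 2) * C, ENNReal.mul_lt_top ENNReal.ofReal_lt_top hC,
        fun t ht => ?_⟩
      simp only [timeRescale_apply]
      rw [lintegral_enorm_sq_const_smul]
      exact mul_le_mul_right (hb (a * t) ⟨mul_nonneg ha.le ht.1,
        mul_le_mul_of_nonneg_left ht.2 ha.le⟩) _
    radius := W.radius
    τ := fun k => W.τ k / a
    τ_mem := fun k => ⟨div_nonneg (W.τ_mem k).1 ha.le, div_lt_div_of_pos_right (W.τ_mem k).2 ha⟩
    c₁ := a * W.c₁
    c₂ := a * W.c₂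
    c₃ := W.c₃ / a
    c₁_pos := mul_pos ha W.c₁_pos
    clock := by
      intro k
      have h := W.clock k
      have hApos := R.A_pos k
      rw [show W.T / a - W.τ (k + 1) / a = (W.T - W.τ (k + 1)) / a by ring,
        div_div, show a * R.A k = R.A k * a by ring, ← div_div]
      exact div_le_div_of_nonneg_right h ha.le
    floor := by
      intro k
      obtain ⟨x, hxR, hfl⟩ := W.floor k
      refine ⟨x, hxR, ?_⟩
      rw [timeRescale_apply, mul_div_cancel₀ _ ha.ne', norm_smul, Real.norm_of_nonneg ha.le,
        mul_assoc]
      exact mul_le_mul_of_nonneg_left hfl ha.le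
    ceiling := by
      intro k t ht x
      rw [timeRescale_apply, norm_smul, Real.norm_of_nonneg ha.le, mul_assoc]
      refine mul_le_mul_of_nonneg_left (W.ceiling k (a * t) ⟨mul_nonneg ha.le ht.1, ?_⟩ x) ha.le
      have := mul_le_mul_of_nonneg_left ht.2 ha.le
      rwa [mul_div_cancel₀ _ ha.ne'] at this }

end Realisation

/-- **One viscosity gives all.** A realisation at a single viscosity `μ > 0` proves `PalasekStep2 R`
(which quantifies over all `ν > 0`), by `Realisation.rescale`. [cite: Tao2011, footnote 3] -/
theorem palasekStep2_of_realisation {μ : ℝ} {R : TowerRates} (hμ : 0 < μ) (W : Realisation μ R) :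
    PalasekStep2 R :=
  fun _ν hν => ⟨W.rescale hμ hν⟩

/-- **The crux at unit viscosity.** `PalasekStep2 R` holds iff the interface is inhabited at
`ν = 1` (Palasek's own normalisation `ν = 1`, §3 of the source). [cite: Palasek2026ElementaryModel, §3] -/
theorem palasekStep2_iff_unitViscosity (R : TowerRates) :
    PalasekStep2 R ↔ Nonempty (Realisation 1 R) :=
  ⟨fun h => h 1 one_pos, fun ⟨W⟩ => palasekStep2_of_realisation one_pos W⟩

/-- **The E-C bridge from a single instance.** One realisation of the tower at one viscosity, plus
Tao's unconditional uniqueness with its force slot, gives Fefferman's (C).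
[cite: FeffermanClay2006, (C)] [cite: Tao2011, Cor. 11.4 and footnote 3] -/
theorem navierStokesBreakdownR3_of_realisation {μ : ℝ} {R : TowerRates} (hμ : 0 < μ)
    (W : Realisation μ R) (hU : tao_unconditional_uniqueness_velocity_forced) :
    Summit.NavierStokesRegularity.NavierStokesRegularity.NavierStokesBreakdownR3 :=
  navierStokesBreakdownR3_of_step2 R hU (palasekStep2_of_realisation hμ W)

end Summit.NavierStokesRegularity.FluidComputer.PalasekTowerClayBridge

end
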